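import Summits.QuantumFields.YangMills.Theorems.ThermalTraceWindowSubFemtoFirstLevelRungFixedL
import Summits.QuantumFields.YangMills.Theorems.ThermalTraceWindowTwoLevelPopulation
import Summits.QuantumFields.YangMills.Theorems.ThermalTraceWindowFewBodyEntropyRungFixedL
import HarnessLib

/-!
# The fixed-lattice instances of K2 `ThermalTraceWindow.SubFemtoTraceRatio` (item stmt-QuantumFields-28257) and of
# `SlowBitWindow.SubFemtoEntropy` ∕ `SwapTwistDeficit.SubFemtoEntropy` (stmt-QuantumFields-23272) — PROVED

Route `ThermalTraceWindow` (LINE of seat ym-idea-4) names as its CHEAPEST FALSIFIER the fixed-`L` instance of K2: «with the proved trace formula,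
the dyadic ratio `Z_phys(2L)/Z_phys(L)²` must be `≤ 1 − β^{-k}` for large `β`; if instead the ratio `→ 1` (only ONE state populated) every
normalisation here is wrong».  With K2a at every fixed `L` (`subFemtoFirstLevel_rung_fixedL`, swap-pair min–max) and the proved two-level algebra
K2b (`twoLevelPopulation_holds`) the falsifier is DECIDED IN FAVOUR OF THE LINE at every lattice size:

* ★ `subFemtoTraceRatio_rung_fixedL : ∀ L ≥ 2, ∃ k β₀, ∀ β ≥ β₀, Z_phys(2L) ≤ (1 − β^{-k}) · Z_phys(L)²` — at least two zero-flux transfer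
  states are thermally populated to within a power of `β`, at every fixed `L`;
* `subFemtoEntropy_rung_fixedL : ∀ L ≥ 2, ∃ q β₀, ∀ β ≥ β₀, Z_phys(L) ≤ β^q λ₀^L` — the fixed-`L` instance of `SubFemtoEntropy` (from the K1a rung
  `physTrace_le_poly_mul_levelValue_zero_pow`, absorbing its constant into one more power of `β`).

HONEST FRAMING: fixed-lattice instances only (exponents and thresholds depend on `L`); the cruxes K2/K2a/`SubFemtoEntropy` ask for UNIFORMITY along
the sub-femto window `L ≤ β^A`, which is renormalisation-group content not touched here.  No summit, no mass gap; R2ξ″ and the Clay problem OPEN.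
No `sorry`, no new axiom, no new definition.  References: [cite: Luscher1983, §2]; [cite: MontvayMunster1994, (3.145)]; [cite: ReedSimonIV1978, Thm. XIII.1].
-/

noncomputable section

open MeasureTheory Filter Topology Real
open Literature.MathematicalPhysics.QuantumLattice
open Literature.MathematicalPhysics.QuantumFieldTheory hiding SU2
open Summit.QuantumFields.YangMills.Theorems
open Summit.QuantumFields.YangMills.Theorems.FemtoTransferGap

namespace Summit.QuantumFields.YangMills.Theses.ThermalTraceWindow

/-- ★ **K2 at every fixed lattice size** (the route's «cheapest falsifier», decided positively): for every `L ≥ 2` there are `k, β₀` with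
`Z_phys(2L) ≤ (1 − β^{-k}) Z_phys(L)²` for all `β ≥ β₀`.  (K2a at fixed `L`: `x = (λ₁/λ₀)^L ≥ β^{-k}`; K2b: `Z(2L) ≤ (1 − x/2) Z(L)²`;
`β^{-k}/2 ≥ β^{-(k+1)}` for `β ≥ 2`.) [cite: MontvayMunster1994, (3.145)] [cite: ReedSimonIV1978, Thm. XIII.1] -/
theorem subFemtoTraceRatio_rung_fixedL (L : ℕ) [NeZero L] (hL : 2 ≤ L) :
    ∃ k β₀ : ℝ, ∀ β : ℝ, β₀ ≤ β →
      TT.physTrace L β (2 * L) ≤ (1 - β ^ (-k)) * TT.physTrace L β L ^ 2 := by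
  obtain ⟨k, β₀, hK2a⟩ := subFemtoFirstLevel_rung_fixedL L
  refine ⟨k + 1, max β₀ 2, fun β hβ => ?_⟩
  have hβ₀ : β₀ ≤ β := (le_max_left _ _).trans hβ
  have hβ2 : 2 ≤ β := (le_max_right _ _).trans hβ
  have hβ1 : 1 ≤ β := by linarith
  have hβ0 : 0 < β := by linarith
  have hl0 : 0 < levelValue su2Rep L β 0 := levelValue_zero_su2Rep_pos L β
  have hl0L : 0 < levelValue su2Rep L β 0 ^ L := pow_pos hl0 L
  -- `x = (λ₁/λ₀)^L ≥ β^{-k}`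
  set x : ℝ := (levelValue su2Rep L β 1 / levelValue su2Rep L β 0) ^ L with hx
  have hxk : β ^ (-k) ≤ x := by
    rw [hx, div_pow, le_div_iff₀ hl0L]
    exact hK2a β hβ₀
  -- K2b
  have hK2b := twoLevelPopulation_holds L β hβ1 hL
  have hZ0 : 0 ≤ TT.physTrace L β L ^ 2 := sq_nonneg _
  -- `1 − x/2 ≤ 1 − β^{-(k+1)}`
  have hcoef : 1 - x / 2 ≤ 1 - β ^ (-(k + 1)) := by
    have h1 : β ^ (-(k + 1)) = β ^ (-k) * β⁻¹ := by
      rw [neg_add, Real.rpow_add hβ0, Real.rpow_neg_one]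
    have h2 : β⁻¹ ≤ 1 / 2 := by rw [inv_le_comm₀ hβ0 (by norm_num), one_div, inv_inv]; exact hβ2
    have h3 : β ^ (-(k + 1)) ≤ β ^ (-k) * (1 / 2) := by
      rw [h1]; exact mul_le_mul_of_nonneg_left h2 (Real.rpow_nonneg hβ0.le _)
    linarith
  calc TT.physTrace L β (2 * L) ≤ (1 - x / 2) * TT.physTrace L β L ^ 2 := hK2b
    _ ≤ (1 - β ^ (-(k + 1))) * TT.physTrace L β L ^ 2 := mul_le_mul_of_nonneg_right hcoef hZ0

/-- **`SubFemtoEntropy` at every fixed lattice size**: for every `L ≥ 2` there are `q, β₀` with `Z_phys(L) ≤ β^q λ₀(β,L)^L` for `β ≥ β₀` (the K1a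
rung `Z_phys(L) ≤ C_L β^{q_L} λ₀^L`, `β ≥ 1`, with `C_L ≤ β` absorbed into one more power). [cite: Luscher1983, §2] [cite: MontvayMunster1994, (3.145)] -/
theorem subFemtoEntropy_rung_fixedL (L : ℕ) [NeZero L] (hL : 2 ≤ L) :
    ∃ q β₀ : ℝ, ∀ β : ℝ, β₀ ≤ β →
      TT.physTrace L β L ≤ β ^ q * levelValue su2Rep L β 0 ^ L := by
  obtain ⟨C, q, hC, h⟩ := physTrace_le_poly_mul_levelValue_zero_pow L hL
  refine ⟨q + 1, max 1 C, fun β hβ => ?_⟩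
  have hβ1 : 1 ≤ β := (le_max_left _ _).trans hβ
  have hβC : C ≤ β := (le_max_right _ _).trans hβ
  have hβ0 : 0 < β := by linarith
  have hl0 : 0 ≤ levelValue su2Rep L β 0 ^ L := pow_nonneg (levelValue_zero_su2Rep_pos L β).le L
  calc TT.physTrace L β L ≤ C * β ^ q * levelValue su2Rep L β 0 ^ L := h β hβ1
    _ ≤ β * β ^ q * levelValue su2Rep L β 0 ^ L :=
        mul_le_mul_of_nonneg_right (mul_le_mul_of_nonneg_right hβC (Real.rpow_nonneg hβ0.le _)) hl0
    _ = β ^ (q + 1) * levelValue su2Rep L β 0 ^ L := by rw [Real.rpow_add hβ0, Real.rpow_one]; ring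

end Summit.QuantumFields.YangMills.Theses.ThermalTraceWindow

end
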